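import Summits.NavierStokesRegularity.NavierStokesRegularity.Theorems.PerpetualPumpAveragedTypeIBlowupPreBootTrail
import Summits.NavierStokesRegularity.NavierStokesRegularity.Theorems.PerpetualPumpAveragedTypeIBlowupPreBootLadder
import Summits.NavierStokesRegularity.NavierStokesRegularity.Theorems.PerpetualPumpAveragedTypeIBlowupPreBootFront
import Summits.NavierStokesRegularity.NavierStokesRegularity.Theorems.PerpetualPumpAveragedTypeIBlowupPreBootPrev

/-!
# Crux `PerpetualPump.AveragedTypeIBlowup` (stmt-NavierStokesRegularity-1835), line `Sketch`:
# stub `preBoot` — the pre-ignition bootstrap of the window one-step theorem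

Last file of the proof of the registered stub `stub_preBoot` of the line skeleton
`Cruxes/AveragedTypeIBlowup/Lines/Sketch.lean`. First the step of the joint continuous induction
(`preBoot_step`): on a pre-ignition horizon on which every mode satisfies the 2× looser bounds,
the five phase lemmas (`preBoot_trail`, `preBoot_prevPair`, `preBoot_front`, `preBoot_levelOne`,
`preBoot_ladder`) return the tight boxes, in the order trail → previous pair → front → level-1 →
ladder. Then `stub_preBoot`: the joint continuous induction in real time on
the loose boxes (`preBoot_induction`; base and tight boxes at `t₀` from `preBoot_pre_t0`;
closedness by continuity, `incubation_le_of_Ico`; openness because the tight boxes returned by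
`preBoot_step` are strictly inside the loose ones and strict inequalities between continuous
functions persist, `preBoot_eventually_lt` / `preBoot_eventually_delta`, finitely many trail modes
at a time, `Set.Finite.eventually_all`), and the assembly of the box `Pre`, the positivity of
the front bond, the transfer budget and NEW-1 / NEW-2 from `preBoot_step` at the horizon.

## References

T. Tao, *Finite time blowup for an averaged three-dimensional Navier–Stokes equation*, J. Amer.
Math. Soc. 29 (2016), 601–674, §5–6 (the cascade / circuit heuristics); the estimates are
folklore ODE bookkeeping.
-/

noncomputable section

-- the summit namespace `…NavierStokesRegularity.NavierStokesRegularity…` is the tree convention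
set_option linter.dupNamespace false

open Set MeasureTheory Filter Topology

namespace Summit.NavierStokesRegularity.NavierStokesRegularity.Theorems.PerpetualPumpAveragedTypeIBlowup
set_option maxHeartbeats 800000 in
/-- **The tight boxes from the loose ones (one step of the joint continuous induction).** On a
pre-ignition horizon `[t₀, S]` (`0 < R_n(S − t₀) ≤ 3`), if every mode satisfies the 2× LOOSER
bounds, then every mode satisfies its TIGHT box on `[t₀, S]`: the trail (`preBoot_trail`), the
previous pair (`preBoot_prevPair`, fed by the tight trail bond `w_{n−2}`), the front
(`preBoot_front`), the level-1 pair (`preBoot_levelOne`, fed by the front) and the ladder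
(`preBoot_ladder`); the front also yields positivity of its bond, the transfer budget and the two
ignition-budget inequalities at `S`. [folklore] -/
theorem preBoot_step {ε₀ D εb θ η F blo bhi q T t₀ S B : ℝ} {n₀ n : ℤ} {lad : ℕ → ℝ}
    {bv wv M0 M1 db dw G0 G1 : ℤ → ℝ → ℝ} {R : ℤ → ℝ}
    (hq : q = Real.sqrt (1 + ε₀)) (hR : ∀ k : ℤ, R k = D * (1 + ε₀) ^ (2 * k))
    (hlad : ∀ j : ℕ, lad j = εb * ((1 + ε₀) ^ (19 * (j - 2)))⁻¹)
    (hG0 : ∀ (k : ℤ) (t : ℝ), G0 k t = (wv (k - 1) t) ^ 2 / q ^ 3 - (wv k t) ^ 2 - εb * bv k t * wv k t)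
    (hG1 : ∀ (k : ℤ) (t : ℝ), G1 k t = wv k t * (bv k t - bv (k + 1) t / q) + εb * (bv k t) ^ 2)
    (hε₀ : 0 < ε₀) (hε₀' : ε₀ ≤ 1 / 20) (hD : 0 < D) (hθ : 1 / 2 ≤ θ) (hθ1 : θ ≤ 1) (hη : 0 ≤ η)
    (hεb : 0 < εb) (hεb6 : εb ≤ 1 / 10 ^ 6) (hblo : 10 ^ 4 + 40 - 5 * Real.log εb ≤ blo)
    (hF : 10 ^ 9 * (bhi + 4) ^ 4 ≤ F) (hηreg : η * (10 ^ 9 * (bhi + 4) ^ 4 * (F + 1)) ≤ 1)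
    (hεbreg : εb * (10 ^ 9 * (F + 1) ^ 2 * (bhi + 4) ^ 3) ≤ 1)
    (hseed : 10 ^ 3 + 20 * Real.log (bhi + 5) + Real.log (F + 2) ≤ -Real.log εb)
    (ht₀ : 0 ≤ t₀) (hBlo : blo ≤ B) (hBhi : B ≤ bhi)
    (hzero : ∀ k : ℤ, k < n₀ → ∀ t ∈ Icc 0 T, bv k t = 0 ∧ wv k t = 0 ∧ M0 k t = 0 ∧ M1 k t = 0)
    (hcont : ∀ k : ℤ, ContinuousOn (bv k) (Icc 0 T) ∧ ContinuousOn (wv k) (Icc 0 T) ∧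
      ContinuousOn (M0 k) (Icc 0 T) ∧ ContinuousOn (M1 k) (Icc 0 T))
    (hC1 : ∀ k : ℤ, ContinuousOn (db k) (Icc 0 T) ∧ ContinuousOn (dw k) (Icc 0 T) ∧
      ∀ t ∈ Ioo 0 T, HasDerivAt (bv k) (db k t) t ∧
        |db k t - R k * (-(bv k t) + G0 k t)| ≤ η * R k * M0 k t ∧
        HasDerivAt (wv k) (dw k t) t ∧ |dw k t - R k * (-(wv k t) + G1 k t)| ≤ η * R k * M1 k t)
    (hmaj : ∀ k : ℤ, ∀ t ∈ Icc 0 T, |bv k t| ≤ M0 k t ∧ |wv k t| ≤ M1 k t ∧ 0 ≤ M0 k t ∧ 0 ≤ M1 k t)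
    (hrest : ∀ k : ℤ, ∀ t₁ ∈ Icc 0 T, ∀ t₂ ∈ Icc t₁ T,
      M0 k t₂ ≤ M0 k t₁ * Real.exp (-(θ * R k * (t₂ - t₁))) +
          R k * ∫ u in t₁..t₂, Real.exp (-(θ * R k * (t₂ - u))) * |G0 k u| ∧
        M1 k t₂ ≤ M1 k t₁ * Real.exp (-(θ * R k * (t₂ - t₁))) +
          R k * ∫ u in t₁..t₂, Real.exp (-(θ * R k * (t₂ - u))) * |G1 k u|)
    (hTail : ∃ J : ℕ, ∀ j : ℕ, J ≤ j → ∀ t ∈ Icc 0 T,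
      |bv (n + j) t| ≤ lad j ∧ |wv (n + j) t| ≤ lad j / 5 ∧ M0 (n + j) t ≤ lad j ∧ M1 (n + j) t ≤ lad j)
    (hInv : bv n t₀ = B ∧ (∀ s ∈ Icc 0 t₀, bv n s ≤ B) ∧
      (0 ≤ wv n t₀ ∧ wv n t₀ ≤ F * εb * B ∧ M1 n t₀ ≤ F * εb * B ∧ M0 n t₀ ≤ 2 * B) ∧
      (n₀ ≤ n - 1 → 0 ≤ wv (n - 1) t₀ ∧ q ^ 3 * B - 1 ≤ (wv (n - 1) t₀) ^ 2 ∧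
        (wv (n - 1) t₀) ^ 2 ≤ q ^ 3 * B + 1 ∧ 9 / 20 ≤ bv (n - 1) t₀ ∧ bv (n - 1) t₀ ≤ 11 / 20 ∧
        M0 (n - 1) t₀ ≤ 5 * (bhi + 4) ^ 2 ∧ M1 (n - 1) t₀ ≤ 5 * (bhi + 4) ^ 2) ∧
      (|bv (n + 1) t₀| ≤ εb ∧ |wv (n + 1) t₀| ≤ εb ∧ M0 (n + 1) t₀ ≤ εb ∧ M1 (n + 1) t₀ ≤ εb) ∧
      (∀ j : ℕ, 2 ≤ j → |bv (n + j) t₀| ≤ lad j ∧ |wv (n + j) t₀| ≤ lad j / 5 ∧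
        M0 (n + j) t₀ ≤ lad j ∧ M1 (n + j) t₀ ≤ lad j) ∧
      (∀ j : ℕ, 1 ≤ j → ∀ s ∈ Icc 0 t₀, bv (n + j) s ≤ 1 / 2) ∧
      (∀ k : ℤ, n₀ ≤ k → k ≤ n - 2 → ∃ te ∈ Icc 0 t₀,
        (-(2 / 5) ≤ bv k te ∧ bv k te ≤ 3 / 10 ∧ |wv k te| ≤ 1 / 200 ∧
          M0 k te ≤ 10 * (bhi + 4) ^ 2 ∧ M1 k te ≤ 10 * (bhi + 4) ^ 2) ∧
        ∀ s ∈ Icc te t₀, -(9 / 20) ≤ bv k s ∧ bv k s ≤ 7 / 20 ∧ |wv k s| ≤ 1 / 100 ∧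
          M0 k s ≤ 10 * (bhi + 4) ^ 2 + 1 ∧ M1 k s ≤ 10 * (bhi + 4) ^ 2 + 1 ∧
          |wv (k - 1) s| ≤ 1 / 100 ∧ -(1 / 2) ≤ bv (k + 1) s ∧ bv (k + 1) s ≤ 9 / 10))
    (hT : 0 < T) (hS : t₀ < S) (hST : S ≤ T) (hS3 : R n * (S - t₀) ≤ 3)
    (hnoig : ∀ u ∈ Icc t₀ S, (wv n u) ^ 2 ≤ bv n u / 100)
    (hL : ∀ u ∈ Icc t₀ S,
      (-(1 / 2) ≤ bv n u ∧ bv n u ≤ B + 3 ∧ B * Real.exp (-(R n * (u - t₀))) - 3 ≤ bv n u) ∧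
      (n₀ ≤ n - 1 → -(1 / 50) ≤ wv (n - 1) u ∧ (wv (n - 1) u) ^ 2 ≤ q ^ 3 * B + 4 ∧
        -(1 / 2) ≤ bv (n - 1) u ∧ bv (n - 1) u ≤ 9 / 10 ∧
        (1 + ε₀) ^ (-(2 : ℤ)) * R n * ∫ t in t₀..u, (wv (n - 1) t) ^ 2 ≤ 9 / 5) ∧
      (|bv (n + 1) u| ≤ 1 / 2 ∧ |wv (n + 1) u| ≤ 22 / 10 * εb) ∧ |bv (n + 2) u| ≤ 1 / 2 ∧
      (∀ k : ℤ, n₀ ≤ k → k ≤ n - 2 → |wv k u| ≤ 1 / 50 ∧ -(1 / 2) ≤ bv k u ∧ bv k u ≤ 9 / 10)) :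
    (∀ k : ℤ, n₀ ≤ k → k ≤ n - 2 → ∀ u ∈ Icc t₀ S,
      -(9 / 20) ≤ bv k u ∧ bv k u ≤ 7 / 20 ∧ |wv k u| ≤ 1 / 100 ∧
        M0 k u ≤ 10 * (bhi + 4) ^ 2 + 1 ∧ M1 k u ≤ 10 * (bhi + 4) ^ 2 + 1) ∧
    (n₀ ≤ n - 1 → ∀ u ∈ Icc t₀ S, -(1 / 100) ≤ wv (n - 1) u ∧ (wv (n - 1) u) ^ 2 ≤ q ^ 3 * B + 2 ∧
      -(2 / 5) ≤ bv (n - 1) u ∧ bv (n - 1) u ≤ 17 / 20 ∧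
      (t₀ + 2 * (100 + 4 * Real.log (bhi + 5)) / (B * R n) ≤ u →
        |wv (n - 1) u| ≤ 1 / 200 ∧ bv (n - 1) u ≤ 3 / 10) ∧
      M0 (n - 1) u ≤ 6 * (bhi + 4) ^ 2 ∧ M1 (n - 1) u ≤ 6 * (bhi + 4) ^ 2 ∧
      (1 + ε₀) ^ (-(2 : ℤ)) * R n * ∫ t in t₀..u, (wv (n - 1) t) ^ 2 ≤ 9 / 10) ∧
    (∀ u ∈ Ioc t₀ S, 0 < wv n u) ∧
    (∀ u ∈ Icc t₀ S, B * Real.exp (-(R n * (u - t₀))) - 3 / 2 ≤ bv n u ∧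
      bv n u ≤ B * Real.exp (-(R n * (u - t₀))) + 5 / 2 ∧ 0 ≤ wv n u ∧ M0 n u ≤ 6 * (B + 3) ∧
      M1 n u ≤ F * εb * B + 2 * wv n u + 2 * εb * (B + 3) ^ 2 * (R n * (u - t₀))) ∧
    R n * ∫ t in t₀..S, (wv n t) ^ 2 ≤ 1 / 100 ∧
    B * (1 - Real.exp (-(R n * (S - t₀)))) ≤
      max 0 (Real.log (6 / 10 * Real.sqrt (B + 4) / (εb * B))) + 6 * (R n * (S - t₀) + 1) + 2 ∧
    (bv n S / 100 ≤ (wv n S) ^ 2 →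
      bv n S ≤ B + Real.log (10 * (F + 2) * εb * B) + 6 * (R n * (S - t₀) + 1)) ∧
    (∀ u ∈ Icc t₀ S, |bv (n + 1) u| ≤ εb + q / 100 + 1 / 10 ^ 3 ∧ |wv (n + 1) u| ≤ 11 / 10 * εb ∧
      M0 (n + 1) u ≤ εb + (B + 3) / 40 ∧ M1 (n + 1) u ≤ 4 * εb) ∧
    (∀ j : ℕ, 2 ≤ j → ∀ u ∈ Icc t₀ S, |bv (n + j) u| ≤ lad j ∧ |wv (n + j) u| ≤ lad j / 5 ∧
      M0 (n + j) u ≤ lad j ∧ M1 (n + j) u ≤ lad j) := by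
  obtain ⟨-, hB4, hB1, hF0, -, -, hq1, -⟩ :=
    oneStepCore_regime hε₀ hε₀' hεb hεb6 hblo hF hεbreg hBlo hBhi hq
  have hbhi : 1 ≤ bhi + 4 := by linarith
  obtain ⟨hb0, -, hF4, hP, h1, hLad, -, hTr⟩ := hInv
  have htr := preBoot_trail ε₀ D εb θ η F bhi q T t₀ S n₀ n bv wv M0 M1 db dw G0 G1 R hq hR hG0
    hG1 hε₀ hε₀' hD hθ hθ1 hη hεb hεb6 hF0 hbhi hηreg hzero
    hcont hC1 hmaj hrest hT hS.le hST hTr (fun u hu k hk1 hk2 => (hL u hu).2.2.2.2 k hk1 hk2)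
    (fun hn1 u hu => ⟨((hL u hu).2.1 hn1).2.2.1, ((hL u hu).2.1 hn1).2.2.2.1⟩)
  have hpp : n₀ ≤ n - 1 → _ := fun hn1 => preBoot_prevPair ε₀ D εb θ η F blo bhi q T t₀ S B n₀ n bv
    wv M0 M1 db dw G0 G1 R hq hR hG0 hG1 hε₀ hε₀' hD hθ hθ1 hη hεb hεb6 hblo hF hηreg hεbreg hseed hBlo hBhi hzero hcont hC1 hmaj hrest hT ht₀ hS hST hS3
    hn1 (hP hn1) (fun hn2 u hu => (htr (n - 2) hn2 le_rfl u hu).2.2.1) (fun u hu => (hL u hu).1)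
  obtain ⟨fpos, fenv, fint, fN1, fN2⟩ := preBoot_front ε₀ D εb θ η F blo bhi q T t₀ S B n₀ n bv wv
    M0 M1 db dw G0 G1 R hq hR hG0 hG1 hε₀ hε₀' hD hθ hθ1 hη hεb hεb6 hblo hF hηreg hεbreg hBlo hBhi hzero hcont hC1 hmaj hrest hT ht₀ hS hST hS3
    ⟨hb0, hF4.1, hF4.2.1, hF4.2.2.1, hF4.2.2.2⟩ hnoig (fun u hu => (hL u hu).2.2.1.1)
    (fun hn1 u hu => ⟨((hL u hu).2.1 hn1).2.1, ((hL u hu).2.1 hn1).2.2.2.2⟩)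
  have hl1 := preBoot_levelOne hq hR hG0 hG1 hε₀ hε₀' hD hθ hθ1 hη hεb hεb6 hF0 hbhi hηreg hB1
    hBhi hcont hC1 hmaj hrest hT ht₀ hS.le hST hS3 h1 hnoig (fun u hu => (fenv u hu).2.1) fint
    (fun u hu => (hL u hu).2.2.2.1)
  have hld := preBoot_ladder ε₀ D εb θ η F bhi q T t₀ S n lad bv wv M0 M1 db dw G0 G1 R hq hR
    hlad hG0 hG1 hε₀ hε₀' hD hθ hθ1 hη hεb hεb6 hF0 hbhi hηreg
    hcont hC1 hmaj hrest hT ht₀ hS.le hST hTail hLad (fun u hu => (hL u hu).2.2.1.2)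
  exact ⟨htr, hpp, fpos, fenv, fint, fN1, fN2, hl1, hld⟩


/-- **The front envelope stays above `1` on a pre-ignition horizon**: `B e^{-σ} > 1` for
`B ≥ 10⁴`, `0 ≤ σ ≤ 3` (`e³ < 21`); this is why the tight front box `b_n ≥ B e^{-σ} − 3/2` is
strictly inside the loose one `b_n ≥ −1/2`. Registered tools sub-goal `preBoot_envelope_gt_one`
of the stub `preBoot` (the registered signature of `stub_preBoot` itself exceeds the registration
size limit, so this small lemma is the registered anchor of the final file). [folklore] -/
theorem preBoot_envelope_gt_one :
    ∀ (B σ : ℝ), 10 ^ 4 ≤ B → 0 ≤ σ → σ ≤ 3 → 1 < B * Real.exp (-σ) ∧ B * Real.exp (-σ) ≤ B := by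
  intro B σ hB hσ0 hσ3
  have hB0 : 0 ≤ B := by linarith
  have he2 : 1 / 21 ≤ Real.exp (-σ) := by
    have h1 : Real.exp (-3) ≤ Real.exp (-σ) := Real.exp_le_exp.2 (by linarith)
    have h2 : 1 / 21 ≤ Real.exp (-3) := by
      rw [Real.exp_neg, one_div, inv_le_inv₀ (by norm_num) (Real.exp_pos 3)]
      exact preBoot_exp_three.le
    linarith
  have he3 := mul_le_mul_of_nonneg_left he2 hB0
  exact ⟨by linarith, mul_le_of_le_one_right hB0 (Real.exp_le_one_iff.2 (by linarith))⟩

set_option maxHeartbeats 1600000 in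
/-- **Registered stub `stub_preBoot`** (line `Sketch` of crux `PerpetualPump.AveragedTypeIBlowup`,
stmt-NavierStokesRegularity-1835): THE PRE-IGNITION BOOTSTRAP of the window one-step theorem.
While the front bond has not ignited (`w_n² ≤ b_n/100` on `[t₀, t']`, `R_n(t' − t₀) ≤ 3`), every
mode of the critical Toda system with memory errors stays in its tight box `Pre` (front envelope,
relaxing previous pair with its dump, tiny level-1 pair, slaved ladder, quiet trail), the front
bond is positive after `t₀`, its transfer is `R_n ∫ w_n² ≤ 1/100`, and the two ignition-budget
inequalities NEW-1/NEW-2 hold. Proof: one joint continuous induction in real time on the 2×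
looser boxes (`preBoot_induction`; base `preBoot_pre_t0`; closedness by continuity; at a good
time the phase lemmas return the tight boxes, `preBoot_step`, which are strictly inside the loose
ones, and continuity extends the loose boxes a little further). [folklore] -/
theorem stub_preBoot :
    ∀ (ε₀ D εb θ η F blo bhi : ℝ) (n₀ : ℤ) (bv wv M0 M1 db dw : ℤ → ℝ → ℝ) (q : ℝ) (R : ℤ → ℝ) (lad : ℕ → ℝ)
      (G0 G1 : ℤ → ℝ → ℝ) (Inv : ℤ → ℝ → ℝ → Prop) (Tube : ℤ → ℝ → Prop) (n : ℤ) (B t₀ T : ℝ),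
      q = Real.sqrt (1 + ε₀) → (∀ k : ℤ, R k = D * (1 + ε₀) ^ (2 * k)) →
      (∀ j : ℕ, lad j = εb * ((1 + ε₀) ^ (19 * (j - 2)))⁻¹) →
      (∀ (k : ℤ) (t : ℝ), G0 k t = (wv (k - 1) t) ^ 2 / q ^ 3 - (wv k t) ^ 2 - εb * bv k t * wv k t) →
      (∀ (k : ℤ) (t : ℝ), G1 k t = wv k t * (bv k t - bv (k + 1) t / q) + εb * (bv k t) ^ 2) →
      (∀ (m : ℤ) (Bm t : ℝ), Inv m Bm t ↔
        (bv m t = Bm ∧ (∀ s ∈ Icc 0 t, bv m s ≤ Bm) ∧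
        (0 ≤ wv m t ∧ wv m t ≤ F * εb * Bm ∧ M1 m t ≤ F * εb * Bm ∧ M0 m t ≤ 2 * Bm) ∧
        (n₀ ≤ m - 1 → 0 ≤ wv (m - 1) t ∧ q ^ 3 * Bm - 1 ≤ (wv (m - 1) t) ^ 2 ∧
          (wv (m - 1) t) ^ 2 ≤ q ^ 3 * Bm + 1 ∧ 9 / 20 ≤ bv (m - 1) t ∧ bv (m - 1) t ≤ 11 / 20 ∧
          M0 (m - 1) t ≤ 5 * (bhi + 4) ^ 2 ∧ M1 (m - 1) t ≤ 5 * (bhi + 4) ^ 2) ∧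
        (|bv (m + 1) t| ≤ εb ∧ |wv (m + 1) t| ≤ εb ∧ M0 (m + 1) t ≤ εb ∧ M1 (m + 1) t ≤ εb) ∧
        (∀ j : ℕ, 2 ≤ j → |bv (m + j) t| ≤ lad j ∧ |wv (m + j) t| ≤ lad j / 5 ∧
          M0 (m + j) t ≤ lad j ∧ M1 (m + j) t ≤ lad j) ∧
        (∀ j : ℕ, 1 ≤ j → ∀ s ∈ Icc 0 t, bv (m + j) s ≤ 1 / 2) ∧
        (∀ k : ℤ, n₀ ≤ k → k ≤ m - 2 → ∃ te ∈ Icc 0 t,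
          (-(2 / 5) ≤ bv k te ∧ bv k te ≤ 3 / 10 ∧ |wv k te| ≤ 1 / 200 ∧
            M0 k te ≤ 10 * (bhi + 4) ^ 2 ∧ M1 k te ≤ 10 * (bhi + 4) ^ 2) ∧
          ∀ s ∈ Icc te t, -(9 / 20) ≤ bv k s ∧ bv k s ≤ 7 / 20 ∧ |wv k s| ≤ 1 / 100 ∧
            M0 k s ≤ 10 * (bhi + 4) ^ 2 + 1 ∧ M1 k s ≤ 10 * (bhi + 4) ^ 2 + 1 ∧ |wv (k - 1) s| ≤ 1 / 100 ∧
            -(1 / 2) ≤ bv (k + 1) s ∧ bv (k + 1) s ≤ 9 / 10))) →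
      (∀ (m : ℤ) (t : ℝ), Tube m t ↔
        ((∀ k : ℤ, k ≤ m + 1 → |bv k t| ≤ 2 * (bhi + 3) ∧ |wv k t| ≤ 2 * (bhi + 3) ∧
          M0 k t ≤ 20 * (bhi + 4) ^ 2 ∧ M1 k t ≤ 20 * (bhi + 4) ^ 2) ∧
        (∀ j : ℕ, 2 ≤ j → |bv (m + j) t| ≤ lad j ∧ |wv (m + j) t| ≤ lad j ∧
          M0 (m + j) t ≤ lad j ∧ M1 (m + j) t ≤ lad j))) →
      -- regime
      0 < ε₀ → ε₀ ≤ 1 / 20 → 0 < D → 1 / 2 ≤ θ → θ ≤ 1 → 0 ≤ η → 0 < εb → εb ≤ 1 / 10 ^ 6 →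
      10 ^ 4 + 40 - 5 * Real.log εb ≤ blo → 10 ^ 9 * (bhi + 4) ^ 4 ≤ F →
      η * (10 ^ 9 * (bhi + 4) ^ 4 * (F + 1)) ≤ 1 → εb * (10 ^ 9 * (F + 1) ^ 2 * (bhi + 4) ^ 3) ≤ 1 →
      10 ^ 3 + 20 * Real.log (bhi + 5) + Real.log (F + 2) ≤ -Real.log εb →
      -- the critical system with memory errors on [0, T]
      n₀ ≤ n → 0 ≤ t₀ → t₀ < T → blo ≤ B → B ≤ bhi →
      (∀ k : ℤ, k < n₀ → ∀ t ∈ Icc 0 T, bv k t = 0 ∧ wv k t = 0 ∧ M0 k t = 0 ∧ M1 k t = 0) →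
      (∀ k : ℤ, ContinuousOn (bv k) (Icc 0 T) ∧ ContinuousOn (wv k) (Icc 0 T) ∧
        ContinuousOn (M0 k) (Icc 0 T) ∧ ContinuousOn (M1 k) (Icc 0 T)) →
      (∀ k : ℤ, ContinuousOn (db k) (Icc 0 T) ∧ ContinuousOn (dw k) (Icc 0 T) ∧
        ∀ t ∈ Ioo 0 T, HasDerivAt (bv k) (db k t) t ∧
          |db k t - R k * (-(bv k t) + G0 k t)| ≤ η * R k * M0 k t ∧
          HasDerivAt (wv k) (dw k t) t ∧ |dw k t - R k * (-(wv k t) + G1 k t)| ≤ η * R k * M1 k t) →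
      (∀ k : ℤ, ∀ t ∈ Icc 0 T, |bv k t| ≤ M0 k t ∧ |wv k t| ≤ M1 k t ∧ 0 ≤ M0 k t ∧ 0 ≤ M1 k t) →
      (∀ k : ℤ, ∀ t₁ ∈ Icc 0 T, ∀ t₂ ∈ Icc t₁ T,
        M0 k t₂ ≤ M0 k t₁ * Real.exp (-(θ * R k * (t₂ - t₁))) +
          R k * ∫ u in t₁..t₂, Real.exp (-(θ * R k * (t₂ - u))) * |G0 k u| ∧
        M1 k t₂ ≤ M1 k t₁ * Real.exp (-(θ * R k * (t₂ - t₁))) +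
          R k * ∫ u in t₁..t₂, Real.exp (-(θ * R k * (t₂ - u))) * |G1 k u|) →
      -- the a-priori far tail above the front, and the hand-off invariant at t₀
      (∃ J : ℕ, ∀ j : ℕ, J ≤ j → ∀ t ∈ Icc 0 T,
        |bv (n + j) t| ≤ lad j ∧ |wv (n + j) t| ≤ lad j / 5 ∧ M0 (n + j) t ≤ lad j ∧ M1 (n + j) t ≤ lad j) →
      Inv n B t₀ →
      ∀ (Pre : ℝ → Prop) (t' : ℝ),
      (∀ s : ℝ, Pre s ↔
        ((B * Real.exp (-(R n * (s - t₀))) - 3 / 2 ≤ bv n s ∧ bv n s ≤ B * Real.exp (-(R n * (s - t₀))) + 5 / 2 ∧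
          0 ≤ wv n s ∧ M0 n s ≤ 6 * (B + 3) ∧
          M1 n s ≤ F * εb * B + 2 * wv n s + 2 * εb * (B + 3) ^ 2 * (R n * (s - t₀))) ∧
        (n₀ ≤ n - 1 → -(1 / 100) ≤ wv (n - 1) s ∧ (wv (n - 1) s) ^ 2 ≤ q ^ 3 * B + 2 ∧
          -(2 / 5) ≤ bv (n - 1) s ∧ bv (n - 1) s ≤ 17 / 20 ∧
          (t₀ + 2 * (100 + 4 * Real.log (bhi + 5)) / (B * R n) ≤ s → |wv (n - 1) s| ≤ 1 / 200 ∧ bv (n - 1) s ≤ 3 / 10) ∧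
          M0 (n - 1) s ≤ 6 * (bhi + 4) ^ 2 ∧ M1 (n - 1) s ≤ 6 * (bhi + 4) ^ 2 ∧
          (1 + ε₀) ^ (-(2 : ℤ)) * R n * ∫ u in t₀..s, (wv (n - 1) u) ^ 2 ≤ 9 / 10) ∧
        (|bv (n + 1) s| ≤ εb + q / 100 + 1 / 10 ^ 3 ∧ |wv (n + 1) s| ≤ 11 / 10 * εb ∧
          M0 (n + 1) s ≤ εb + (B + 3) / 40 ∧ M1 (n + 1) s ≤ 4 * εb) ∧
        (∀ j : ℕ, 2 ≤ j → |bv (n + j) s| ≤ lad j ∧ |wv (n + j) s| ≤ lad j / 5 ∧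
          M0 (n + j) s ≤ lad j ∧ M1 (n + j) s ≤ lad j) ∧
        (∀ k : ℤ, n₀ ≤ k → k ≤ n - 2 → -(9 / 20) ≤ bv k s ∧ bv k s ≤ 7 / 20 ∧ |wv k s| ≤ 1 / 100 ∧
          M0 k s ≤ 10 * (bhi + 4) ^ 2 + 1 ∧ M1 k s ≤ 10 * (bhi + 4) ^ 2 + 1))) →
      t₀ < t' → t' ≤ T → t' ≤ t₀ + 3 / R n →
      (∀ s ∈ Icc t₀ t', (wv n s) ^ 2 ≤ bv n s / 100) →
      (∀ s ∈ Icc t₀ t', Pre s) ∧ (∀ s ∈ Ioc t₀ t', 0 < wv n s) ∧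
      (R n * ∫ u in t₀..t', (wv n u) ^ 2 ≤ 1 / 100) ∧
      B * (1 - Real.exp (-(R n * (t' - t₀)))) ≤
        max 0 (Real.log (6 / 10 * Real.sqrt (B + 4) / (εb * B))) + 6 * (R n * (t' - t₀) + 1) + 2 ∧
      (bv n t' / 100 ≤ (wv n t') ^ 2 → bv n t' ≤ B + Real.log (10 * (F + 2) * εb * B) + 6 * (R n * (t' - t₀) + 1)) := by
  intro ε₀ D εb θ η F blo bhi n₀ bv wv M0 M1 db dw q R lad G0 G1 Inv Tube n B t₀ T hq hR hlad hG0
    hG1 hInvDef _hTubeDef hε₀ hε₀' hD hθ hθ1 hη hεb hεb6 hblo hF hηreg hεbreg hseed hn₀ ht₀ ht₀T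
    hBlo hBhi hzero hcont hC1 hmaj hrest hTail hInv Pre t' hPreDef ht' ht'T ht'3 hnoig
  obtain ⟨hεb1, hB4, hB1, hF0, -, -, hq1, hq21⟩ :=
    oneStepCore_regime hε₀ hε₀' hεb hεb6 hblo hF hεbreg hBlo hBhi hq
  obtain ⟨hRpos, -, -, -, -, -, -, -, -, hq0, -⟩ := preBoot_rates hε₀ hε₀' hD hR hq n
  have hRn := hRpos n
  have hT : 0 < T := by linarith
  have hB0 : 0 ≤ B := by linarith
  have hInv8 := (hInvDef n B t₀).1 hInv
  have hlad2 : lad 2 = εb := by rw [hlad]; norm_num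
  obtain ⟨hclock, hclock0, -⟩ := oneStepCore_clock (t₀ := t₀) hRn
  have hsub : Icc t₀ t' ⊆ Icc 0 T := Icc_subset_Icc ht₀ ht'T
  -- the loose boxes and their strict form
  obtain ⟨L, hL⟩ : ∃ L : ℝ → Prop, ∀ u, L u ↔
      ((-(1 / 2) ≤ bv n u ∧ bv n u ≤ B + 3 ∧ B * Real.exp (-(R n * (u - t₀))) - 3 ≤ bv n u) ∧
      (n₀ ≤ n - 1 → -(1 / 50) ≤ wv (n - 1) u ∧ (wv (n - 1) u) ^ 2 ≤ q ^ 3 * B + 4 ∧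
        -(1 / 2) ≤ bv (n - 1) u ∧ bv (n - 1) u ≤ 9 / 10 ∧
        (1 + ε₀) ^ (-(2 : ℤ)) * R n * ∫ t in t₀..u, (wv (n - 1) t) ^ 2 ≤ 9 / 5) ∧
      (|bv (n + 1) u| ≤ 1 / 2 ∧ |wv (n + 1) u| ≤ 22 / 10 * εb) ∧ |bv (n + 2) u| ≤ 1 / 2 ∧
      (∀ k : ℤ, n₀ ≤ k → k ≤ n - 2 → |wv k u| ≤ 1 / 50 ∧ -(1 / 2) ≤ bv k u ∧ bv k u ≤ 9 / 10)) :=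
    ⟨_, fun _ => Iff.rfl⟩
  obtain ⟨Ls, hLs⟩ : ∃ Ls : ℝ → Prop, ∀ u, Ls u ↔
      ((-(1 / 2) < bv n u ∧ bv n u < B + 3 ∧ B * Real.exp (-(R n * (u - t₀))) - 3 < bv n u) ∧
      (n₀ ≤ n - 1 → -(1 / 50) < wv (n - 1) u ∧ (wv (n - 1) u) ^ 2 < q ^ 3 * B + 4 ∧
        -(1 / 2) < bv (n - 1) u ∧ bv (n - 1) u < 9 / 10 ∧
        (1 + ε₀) ^ (-(2 : ℤ)) * R n * ∫ t in t₀..u, (wv (n - 1) t) ^ 2 < 9 / 5) ∧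
      (|bv (n + 1) u| < 1 / 2 ∧ |wv (n + 1) u| < 22 / 10 * εb) ∧ |bv (n + 2) u| < 1 / 2 ∧
      (∀ k : ℤ, n₀ ≤ k → k ≤ n - 2 → |wv k u| < 1 / 50 ∧ -(1 / 2) < bv k u ∧ bv k u < 9 / 10)) :=
    ⟨_, fun _ => Iff.rfl⟩
  have hweak : ∀ u, Ls u → L u := by
    intro u h
    obtain ⟨⟨a1, a2, a3⟩, hb, ⟨c1, c2⟩, d1, he⟩ := (hLs u).1 h
    refine (hL u).2 ⟨⟨a1.le, a2.le, a3.le⟩, fun h1 => ?_, ⟨c1.le, c2.le⟩, d1.le, fun k hk1 hk2 => ?_⟩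
    · obtain ⟨b1, b2, b3, b4, b5⟩ := hb h1
      exact ⟨b1.le, b2.le, b3.le, b4.le, b5.le⟩
    · obtain ⟨e1, e2, e3⟩ := he k hk1 hk2
      exact ⟨e1.le, e2.le, e3.le⟩
  -- the tight boxes: at `t₀` from the invariant, later from the phase lemmas
  have hPre0 : Pre t₀ := (hPreDef t₀).2 (preBoot_pre_t0 ε₀ εb F bhi q B t₀ n₀ n lad R bv wv M0 M1
    hεb hq1 hB1 hBhi hRn hlad2 hInv8)
  have key := fun (t : ℝ) (ht : t ∈ Ioc t₀ t') (hLt : ∀ u ∈ Icc t₀ t, L u) =>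
    preBoot_step hq hR hlad hG0 hG1 hε₀ hε₀' hD hθ hθ1 hη hεb hεb6 hblo hF hηreg hεbreg hseed ht₀
      hBlo hBhi hzero hcont hC1 hmaj hrest hTail hInv8 hT ht.1 (ht.2.trans ht'T)
      (hclock t (ht.2.trans ht'3))
      (fun u hu => hnoig u ⟨hu.1, hu.2.trans ht.2⟩) (fun u hu => (hL u).1 (hLt u hu))
  have hPreOf : ∀ t ∈ Icc t₀ t', (∀ u ∈ Icc t₀ t, L u) → Pre t := by
    intro t ht hLt
    rcases ht.1.eq_or_lt with h | h
    · rw [← h]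
      exact hPre0
    · obtain ⟨k1, k2, -, k4, -, -, -, k8, k9⟩ := key t ⟨h, ht.2⟩ hLt
      have htt : t ∈ Icc t₀ t := ⟨ht.1, le_rfl⟩
      exact (hPreDef t).2 ⟨k4 t htt, fun hn1 => k2 hn1 t htt, k8 t htt, fun j hj => k9 j hj t htt,
        fun k hk1 hk2 => k1 k hk1 hk2 t htt⟩
  -- the tight boxes are strictly inside the loose ones
  have hstrict : ∀ t ∈ Icc t₀ t', Pre t → Ls t := by
    intro t ht hP
    obtain ⟨⟨f1, f2, -⟩, hP2, ⟨l1, l2, -⟩, hLd, hTr'⟩ := (hPreDef t).1 hP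
    have hσ0 := hclock0 t ht.1
    have hσ3 := hclock t (ht.2.trans ht'3)
    obtain ⟨he3, he1⟩ := preBoot_envelope_gt_one B (R n * (t - t₀)) hB4 hσ0 hσ3
    have hl2 := (hLd 2 le_rfl).1
    simp only [Nat.cast_ofNat, hlad2] at hl2
    refine (hLs t).2 ⟨⟨by linarith, by linarith, by linarith⟩, fun hn1 => ?_,
      ⟨by linarith, by linarith⟩, by linarith, fun k hk1 hk2 => ?_⟩
    · obtain ⟨p1, p2, p3, p4, -, -, -, p8⟩ := hP2 hn1
      exact ⟨by linarith, by linarith, by linarith, by linarith, by linarith⟩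
    · obtain ⟨a1, a2, a3, -⟩ := hTr' k hk1 hk2
      exact ⟨by linarith, by linarith, by linarith⟩
  have hL0 : L t₀ := hweak _ (hstrict t₀ ⟨le_rfl, ht'.le⟩ hPre0)
  -- continuity of the bounding functions on `[t₀, t']`
  have cb : ∀ k, ContinuousOn (bv k) (Icc t₀ t') := fun k => (hcont k).1.mono hsub
  have cw : ∀ k, ContinuousOn (wv k) (Icc t₀ t') := fun k => (hcont k).2.1.mono hsub
  have cab : ∀ k, ContinuousOn (fun u => |bv k u|) (Icc t₀ t') :=
    fun k => continuous_abs.comp_continuousOn (cb k)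
  have caw : ∀ k, ContinuousOn (fun u => |wv k u|) (Icc t₀ t') :=
    fun k => continuous_abs.comp_continuousOn (cw k)
  have cK : ∀ c : ℝ, ContinuousOn (fun _ : ℝ => c) (Icc t₀ t') := fun c => continuousOn_const
  have cexp : ContinuousOn (fun u => B * Real.exp (-(R n * (u - t₀))) - 3) (Icc t₀ t') :=
    ((continuousOn_const.mul ((continuousOn_const.mul
      (continuousOn_id.sub continuousOn_const)).neg.rexp)).sub continuousOn_const)
  have csq : ContinuousOn (fun u => (wv (n - 1) u) ^ 2) (Icc t₀ t') := (cw (n - 1)).pow 2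
  have cint : ContinuousOn (fun u => (1 + ε₀) ^ (-(2 : ℤ)) * R n * ∫ t in t₀..u, (wv (n - 1) t) ^ 2)
      (Icc t₀ t') := continuousOn_const.mul (linearComparison_primitive ht'.le csq).1
  -- closedness of the loose boxes
  have hclosed : ∀ t ∈ Ioc t₀ t', (∀ u ∈ Ico t₀ t, L u) → L t := by
    intro t ht hLt
    have hL' := fun u (hu : u ∈ Ico t₀ t) => (hL u).1 (hLt u hu)
    refine (hL t).2 ⟨⟨?_, ?_, ?_⟩, fun hn1 => ⟨?_, ?_, ?_, ?_, ?_⟩, ⟨?_, ?_⟩, ?_,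
      fun k hk1 hk2 => ⟨?_, ?_, ?_⟩⟩
    · exact incubation_le_of_Ico (cK _) (cb n) ht fun u hu => (hL' u hu).1.1
    · exact incubation_le_of_Ico (cb n) (cK _) ht fun u hu => (hL' u hu).1.2.1
    · exact incubation_le_of_Ico cexp (cb n) ht fun u hu => (hL' u hu).1.2.2
    · exact incubation_le_of_Ico (cK _) (cw _) ht fun u hu => ((hL' u hu).2.1 hn1).1
    · exact incubation_le_of_Ico csq (cK _) ht fun u hu => ((hL' u hu).2.1 hn1).2.1
    · exact incubation_le_of_Ico (cK _) (cb _) ht fun u hu => ((hL' u hu).2.1 hn1).2.2.1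
    · exact incubation_le_of_Ico (cb _) (cK _) ht fun u hu => ((hL' u hu).2.1 hn1).2.2.2.1
    · exact incubation_le_of_Ico cint (cK _) ht fun u hu => ((hL' u hu).2.1 hn1).2.2.2.2
    · exact incubation_le_of_Ico (cab _) (cK _) ht fun u hu => (hL' u hu).2.2.1.1
    · exact incubation_le_of_Ico (caw _) (cK _) ht fun u hu => (hL' u hu).2.2.1.2
    · exact incubation_le_of_Ico (cab _) (cK _) ht fun u hu => (hL' u hu).2.2.2.1
    · exact incubation_le_of_Ico (caw _) (cK _) ht fun u hu => ((hL' u hu).2.2.2.2 k hk1 hk2).1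
    · exact incubation_le_of_Ico (cK _) (cb _) ht fun u hu => ((hL' u hu).2.2.2.2 k hk1 hk2).2.1
    · exact incubation_le_of_Ico (cb _) (cK _) ht fun u hu => ((hL' u hu).2.2.2.2 k hk1 hk2).2.2
  -- openness: strict inequalities at a good time persist a little
  have hopen : ∀ t ∈ Ico t₀ t', (∀ u ∈ Icc t₀ t, L u) →
      ∃ δ : ℝ, 0 < δ ∧ ∀ u ∈ Ioc t (t + δ), u ≤ t' → L u := by
    intro t ht hLt
    have htI : t ∈ Icc t₀ t' := ⟨ht.1, ht.2.le⟩
    obtain ⟨⟨a1, a2, a3⟩, hb, ⟨c1, c2⟩, d1, he⟩ :=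
      (hLs t).1 (hstrict t htI (hPreOf t htI hLt))
    have ev := fun {F G : ℝ → ℝ} (hF : ContinuousOn F (Icc t₀ t')) (hG : ContinuousOn G (Icc t₀ t'))
      (h : F t < G t) => preBoot_eventually_lt (hF t htI) (hG t htI) h
    have evb : ∀ᶠ u in 𝓝[Icc t₀ t'] t, n₀ ≤ n - 1 → -(1 / 50) < wv (n - 1) u ∧
        (wv (n - 1) u) ^ 2 < q ^ 3 * B + 4 ∧ -(1 / 2) < bv (n - 1) u ∧ bv (n - 1) u < 9 / 10 ∧
        (1 + ε₀) ^ (-(2 : ℤ)) * R n * ∫ t in t₀..u, (wv (n - 1) t) ^ 2 < 9 / 5 := by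
      by_cases hn1 : n₀ ≤ n - 1
      · obtain ⟨b1, b2, b3, b4, b5⟩ := hb hn1
        exact ((((ev (cK _) (cw _) b1).and (ev csq (cK _) b2)).and (ev (cK _) (cb _) b3)).and
          ((ev (cb _) (cK _) b4).and (ev cint (cK _) b5))).mono fun u hu _ =>
            ⟨hu.1.1.1, hu.1.1.2, hu.1.2, hu.2.1, hu.2.2⟩
      · exact Filter.Eventually.of_forall fun u h => absurd h hn1
    have eve : ∀ᶠ u in 𝓝[Icc t₀ t'] t, ∀ k ∈ Icc n₀ (n - 2),
        |wv k u| < 1 / 50 ∧ -(1 / 2) < bv k u ∧ bv k u < 9 / 10 := by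
      refine (Set.finite_Icc n₀ (n - 2)).eventually_all.2 fun k hk => ?_
      obtain ⟨e1, e2, e3⟩ := he k hk.1 hk.2
      exact ((ev (caw _) (cK _) e1).and (ev (cK _) (cb _) e2)).and (ev (cb _) (cK _) e3) |>.mono
        fun u hu => ⟨hu.1.1, hu.1.2, hu.2⟩
    have hev : ∀ᶠ u in 𝓝[Icc t₀ t'] t, Ls u := by
      refine ((((ev (cK _) (cb _) a1).and (ev (cb _) (cK _) a2)).and (ev cexp (cb _) a3)).and
        ((evb.and ((ev (cab _) (cK _) c1).and (ev (caw _) (cK _) c2))).and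
        ((ev (cab _) (cK _) d1).and eve))).mono fun u hu => (hLs u).2
          ⟨⟨hu.1.1.1, hu.1.1.2, hu.1.2⟩, hu.2.1.1, hu.2.1.2, hu.2.2.1,
            fun k hk1 hk2 => hu.2.2.2 k ⟨hk1, hk2⟩⟩
    exact preBoot_eventually_delta (hev.mono fun u hu => hweak u hu) ht
  -- the induction and the conclusions
  have hLall := preBoot_induction ht'.le hL0 hclosed hopen
  obtain ⟨-, -, kpos, -, kint, kN1, kN2, -⟩ := key t' ⟨ht', le_rfl⟩ hLall
  exact ⟨fun s hs => hPreOf s hs fun u hu => hLall u ⟨hu.1, hu.2.trans hs.2⟩, kpos, kint, kN1, kN2⟩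

end Summit.NavierStokesRegularity.NavierStokesRegularity.Theorems.PerpetualPumpAveragedTypeIBlowup

end
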